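import Summits.QuantumFields.BalabanUV.Beta.CombChartJointEndReflTablesAn1S2ZScaled
import Summits.QuantumFields.BalabanUV.Beta.CombSecondOrderDeltaSepScaled

/-!
# `BalabanUV.Beta.CombChartJointEndReflTablesAn1S2NScaled` — binder row D1, chart (III″) programme (an2 g56 W-3 l.63100 (D4)∕(D5); leaf-04 g33): **THE κ-TWIN OF THE COMB CHAIN ROOT
# `CombChartJointEndReflTablesAn1S2N`** in the ONE-κ currency of RULING R-D1-g56-4 ∕ A-1 l.63035 ∕ W-3 shape (S): literal `JsB12CombShSym hLc N (symTablesAn1S2w 3 Lc (κ·cΛ) κ) (κ·cΛ) cB`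
# (pin `κ·cΛ` in every Λ slot, mixed table `κ • symMixFFAt (ctr 4 Lc) Lc` in every second-order slot, remainders `κ •` the landed ones at the base pin), the Λ-lock
# `cΛ·Lc⁴ = 2` on the BASE pin verbatim where the parent has it, the group weight κ FREE.  N: the last localisation letter `hΔL` discharged by leaf-03 g50's `CombSecondOrderDeltaSepScaled.hΔL_pinnedW` over leaf-04's Zw; only the parent's ON-CONE theorem (`…_pinned_of_locks_hcomp_…`) is twinned.
# WHAT CHANGES relative to `CombChartJointEndReflTablesAn1S2N`: nothing but these substitutions (text transformed by name; the parent's bound fine-bond index `κ` is renamed `κ₁`; see the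
# parent and its chart-(II) original for the letter-by-letter account).

HONEST FRAMING (cell contract, verbatim): «discharging `BetaPertH` makes Bałaban's UV stability UNCONDITIONAL — a real constructive-QFT
result; it is NOT the continuum limit and NOT the Clay problem.»  HONEST DEPENDENCY: continuum YM on T⁴ ⇐ BetaPertH ∧ nine spine estimates (0/9 proved);
BetaPertH ⇐ (D1) ∧ (D4) ∧ CAP+tail; G-an2-4 gates asym, D1 and NE2/3/4.
DERIVED cell leaf ([folklore] wiring BY NAME; β sub-cell, D1 formalisation swarm leaf prover 04 `b2b-balaban-beta-d1-formalise-leaf-04` gen 33, on the row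
OWNER an2 g56's programme W-3).  No statement of Bałaban's papers, no `[cite:]`, no `Prop` fact, no `def`; every displayed letter is a BINDER; the VALUE
`κ = Lc¹²∕4` enters nowhere here (the chain is κ-generic).  HONEST: composition by name; root classes 0∕4 discharged; row D1 binders 0∕4; ROOT M‴ p325680 and
the root of record untouched; NOT D1, NOT `BetaPertH`, NOT continuum, NOT Clay.  Provenance: β sub-cell, unit b2b-balaban-beta-d1-formalise-leaf-04 gen 33,
2026-08-25 (v1); over leaf-04's `CombChartJointEndReflTablesAn1S2ZScaled` (Zw) and leaf-03 g50's `CombSecondOrderDeltaSepScaled` (P3) BY NAME; no existing file touched.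
-/

noncomputable section

open Finset
open scoped BigOperators
open Literature.Probability.LatticeModels (Torus.proj)
open Literature.MathematicalPhysics.QuantumFieldTheory
open Literature.MathematicalPhysics.QuantumFieldTheory.Balaban1983to89
open Literature.MathematicalPhysics.QuantumFieldTheory.Balaban1983to89.Beta
open Literature.MathematicalPhysics.QuantumFieldTheory.Balaban1983to89.Beta.VectorTailsLoc (fam kfam)
open Literature.MathematicalPhysics.QuantumFieldTheory.Balaban1983to89.Beta.VectorLegVolumeAdapter (MvE)
open B12Sec2to5 (l1 l1_nonneg)
open ExpKernelCalculus (MKer BiLoc VertexFamily comp tr tadpole shiftK)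
open PolarizationSign (reflSign WardTransversal AxisReflectionCovariant)
open KernelReflection (refK)
open ResolventReflection (bref Φ)
open AffineAveraging (box toSite)
open AveragingContoursRooted (ctr ctrOff ctrOff_mem_box)
open OneStepResolventKernel (Fib LocStencil JetData)
open OneStepKernelFamily (KInvStep colH vertexOfK TbalOf flipK D1Tel D1Rep D1Drift)
open KernelWard (divV divW)
open StepJetData (mfNeg wilsonA)
open BalabanStepJetsSucc (mmRead wE wVH)
open SecondOrderResponse (dM W2OfK LocStencilFM)
open BalabanCompositeJets (LocStencil₂)
open BalabanStepW2 (M2Of wB2 wV4)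
open WilsonBiStencil (wilsonW₂)
open WilsonVertex2Sym (wsym22)
open Summit.QuantumFields.BalabanUV.Beta.TameKernelCalculus
open Summit.QuantumFields.BalabanUV.Beta.ChartConjugation (conjV conjW)
open Summit.QuantumFields.BalabanUV.Beta.ChartConjugationDefectEnd (conjDefect sandwichDefect)
open Summit.QuantumFields.BalabanUV.Beta.AxialDressingRooted (one_le_of_neZero)
open Summit.QuantumFields.BalabanUV.Beta.SymmetrisedDressingKernel (coDressKSymAt)
open Summit.QuantumFields.BalabanUV.Beta.SymmetrisedStepJets (SymTables)
open Summit.QuantumFields.BalabanUV.Beta.CombChartStepJets (GcombSh ScombOf SpureCombOf JsB12CombSh0)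
open Summit.QuantumFields.BalabanUV.Beta.CombChartJointEnd (JsB12CombShSym)
open Summit.QuantumFields.BalabanUV.Beta.SpineRooted (M1Of SpureRecOf T2RecOf WrecOf)
open Summit.QuantumFields.BalabanUV.Beta.SymShiftedSpread (bhKStepSh)
open Summit.QuantumFields.BalabanUV.Beta.BorderedHessian (sgnK bhK stepScale diagK)
open Summit.QuantumFields.BalabanUV.Beta.E3ContactGenerator (ctGenM)
open Summit.QuantumFields.BalabanUV.Beta.DshAn1 (Dsh)
open Summit.QuantumFields.BalabanUV.Beta.SymAveragingHessianCounts (symVhSAt symHessFFAt)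
open Summit.QuantumFields.BalabanUV.Beta.SymAveragingMixedJetTables (symMixFFAt)
open Summit.QuantumFields.BalabanUV.Beta.SymSecondOrderTablesAn1 (symVh₂SAn1)
open Summit.QuantumFields.BalabanUV.Beta.SymTablesAn1S2Weighted (symTablesAn1S2w)
open Summit.QuantumFields.BalabanUV.Beta.CombSecondOrderRemainderAn1Scaled (combR2An1W combΔAn1W)
open Summit.QuantumFields.BalabanUV.Beta.CombChartJointEndReflTablesAn1S2ZScaled (d1Drift_JsB12CombShSym_an1TablesS2w_pinned_of_locks_splitLoc_hcomp_D1Tel_D1Rep)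
open Summit.QuantumFields.BalabanUV.Beta.CombSecondOrderDeltaSepScaled (hΔL_pinnedW)

namespace Summit.QuantumFields.BalabanUV.Beta.CombChartJointEndReflTablesAn1S2NScaled

variable {Lc : ℕ} [NeZero Lc]

/-- **ROW D1 — THE κ-LITERAL ROOT AT THE PIN, WITH NO LOCALISATION LETTER LEFT: `D1Drift ⟸ hΛ ∧ hcB ∧ hRm0 ∧ D1Tel ∧ D1Rep`**, every group weight `κ` (+ the route
theorem's own binders) — the κ-twin of ROOT M′ `CombChartJointEndReflTablesAn1S2N.d1Drift_…_pinned_of_locks_hcomp_…` (the theorem on M‴'s cone; the parent's other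
theorem `…_of_locks_contactClass_…` is OFF the cone (census N-1 l.63039) and is NOT twinned): Zw (`CombChartJointEndReflTablesAn1S2ZScaled`) with
`hΔL := CombSecondOrderDeltaSepScaled.hΔL_pinnedW N cΛ κ γ` (leaf-03 g50's P3 — unconditional at `X2s := 0`) BY NAME.  What is left displayed: the Λ-lock on
the base pin, the B-lock, the W-remainder scalar `hRm0` (now read on leaf-03's `combΔAn1W`), `D1Tel`, `D1Rep`.  At `κ = 1` this is the parent's statement.  This is
the theorem P5w (`CombRemainderParityAllScaled`, leaf-01 g42) supplies `hRm0` for.  HONEST: composition by name; NOT D1, NOT `BetaPertH`, NOT continuum, NOT Clay. -/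
theorem d1Drift_JsB12CombShSym_an1TablesS2w_pinned_of_locks_hcomp_D1Tel_D1Rep (hLc : Odd Lc) (hL2 : 2 ≤ Lc) {N : ℕ} (hN : 2 ≤ N) (cΛ κ cB : ℝ)
    -- the two unit locks of an1's TABLE-FIT tier 2
    (hΛ : cΛ * (Lc : ℝ) ^ 4 = 2) (hcB : cB = -((Lc : ℝ) ^ 12 / 4))
    -- the cancellation against the W-REMAINDER `Rm_j` at `X2s := 0` — the repair track's scalar `hRm0` (LOCATED: the (E0) table, HRM0-AN3 §4)
    (hRm0 : ∀ (j : ℕ) (α μ : Fin 4) (y : Fin 4 → ℤ) (ν : Fin 4) (y' : Fin 4 → ℤ),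
      tadpole (GcombSh Lc j)
        ((1 / 2 : ℝ) • conjV (bhKStepSh 3 Lc (Dsh Lc) j) (diagK fun p a => (0 : ℕ → Fin 4 → Fin 4 → (Fin 4 → ℤ) → Fin 4 → (Fin 4 → ℤ) → (Fin 4 → ℤ) → Fib 3 → ℝ) j α ν y' μ y p a - (0 : ℕ → Fin 4 → Fin 4 → (Fin 4 → ℤ) → Fin 4 → (Fin 4 → ℤ) → (Fin 4 → ℤ) → Fib 3 → ℝ) j α μ y ν y' p a) +
          (1 / 2 : ℝ) • (combΔAn1W Lc N cΛ κ (fun j => -((Lc : ℝ) ^ 8 / 2) * wVH 3 Lc j / (stepScale 3 Lc j * (Lc : ℝ) ^ 4)) (0 : ℕ → Fin 4 → Fin 4 → (Fin 4 → ℤ) → Fin 4 → (Fin 4 → ℤ) → (Fin 4 → ℤ) → Fib 3 → ℝ) j α μ y ν y' + combΔAn1W Lc N cΛ κ (fun j => -((Lc : ℝ) ^ 8 / 2) * wVH 3 Lc j / (stepScale 3 Lc j * (Lc : ℝ) ^ 4)) (0 : ℕ → Fin 4 → Fin 4 → (Fin 4 → ℤ) → Fin 4 → (Fin 4 → ℤ)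 → (Fin 4 → ℤ) → Fib 3 → ℝ) j α ν y' μ y)) = 0)
    -- the route theorem's own binders, verbatim
    (a : ℝ) (ha : 0 < a)
    (h12 : B5.Prop12Printed (fam (fun i : ℕ+ × ℕ => ((i.1 : ℕ+) : ℕ)) (fun i => i.1.pos) MvE a ha))
    (h126 : B5.Kernel126_127Printed (kfam (fun i : ℕ+ × ℕ => ((i.1 : ℕ+) : ℕ)) MvE))
    {L : Type*} {SL : Finset L} (hSL : SL.Nonempty) (k : L → Fin 4) {μ ν : Fin 4} (hμν : μ ≠ ν) {Nc : ℝ} (hNc : Nc ≠ 0)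
    (Jc : ∀ m : ℕ, JetData 3 (Lc ^ m))
    (htel : D1Tel Lc (JsB12CombShSym hLc N (symTablesAn1S2w 3 Lc (κ * cΛ) κ) (κ * cΛ) cB) Jc)
    {cc : ℝ} {Mw' : ℕ → ℕ} (hc : 1 ≤ cc) (hMwin : ∀ L : ℕ, 2 ≤ L → 1 ≤ Mw' L ∧ (L : ℝ) ≤ cc * Mw' L) (hML : ∀ L : ℕ, 2 ≤ L → Mw' L ≤ L)
    (hrep : D1Rep Lc Jc Nc μ ν a SL k) :
    D1Drift Lc (JsB12CombShSym hLc N (symTablesAn1S2w 3 Lc (κ * cΛ) κ) (κ * cΛ) cB) Nc μ ν := by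
  exact d1Drift_JsB12CombShSym_an1TablesS2w_pinned_of_locks_splitLoc_hcomp_D1Tel_D1Rep hLc hL2 hN cΛ κ cB hΛ hcB
    (hΔL_pinnedW N cΛ κ (fun j => -((Lc : ℝ) ^ 8 / 2) * wVH 3 Lc j / (stepScale 3 Lc j * (Lc : ℝ) ^ 4))) hRm0 a ha h12 h126 hSL k hμν hNc Jc htel hc hMwin hML hrep

end Summit.QuantumFields.BalabanUV.Beta.CombChartJointEndReflTablesAn1S2NScaled

end
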